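/-
HODGE LADDER — STAGE 4, row 1 (K3 surfaces: powers), road (R2) on the REAL carriers: the junction
"Kuga–Satake–Hodge ∧ HC_AV ⟹ HC_K3Powers" kernel-typed modulo ONE named published fact (Floccari 2026 Thm. 3.5),
with the real-carrier Kuga–Satake definitions of `Literature/AlgebraicGeometry/HodgeTheory/KugaSatakeClassBetti`
(definition request D2).  Sibling of `CorCM/Stage4Interfaces.lean` (at the 400-line limit),
`CorCM/Stage4RowOneInstances.lean` and `CorCM/Stage4RoadR1AbelianTypePieces.lean`.
Literature seat hodge-director-lit-stage4, gen 3; companion document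
run/shared/lean/pub/hodge-director/STAGE4-ABELIAN-MOTIVIC-TYPE.md (v3, §1 and CHANGES IN v3).
-/
import Summits.HodgeConjecture.CorCM.Stage4Interfaces
import Summits.HodgeConjecture.CorCM.Geometry.RiemannEssentialImage
import Literature.AlgebraicGeometry.Surfaces.K3PowersHodgeIffKugaSatakePowers
import HarnessLib

/-!
# Stage 4, row 1, road (R2): `KSH_K3_Betti → HC_AV → HC_K3Powers` (Floccari 2026 Thm. 3.5, direction ⇐), on real carriers

v1 typed the row-1 input "beyond `HC_AV`" as `KSH_K3` in framework `B` (`∀ B : BettiHodgeData ℂ, …`) and the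
junction `HC_K3Powers_of_KSH : KSH_K3 → HC_AV → HC_K3Powers` as a `@[conjecture]` to be proved, with the carrier
note that a real-carrier Kuga–Satake class was a definition request (D2).  v2 (erratum E2) found the junction
PRINTED: Floccari, Geom. Topol. 30 (2026), Thm. 3.5 — "Assume that the Kuga-Satake Hodge conjecture holds for `S`.
Then the Hodge conjecture holds for all powers of `S` if and only if it holds for all powers of its Kuga-Satake
variety `KS(S)`."  With D2 in the tree (`HodgeTheory.IsKSCorrespondenceAlgebraicBetti`, `IsKugaSatakeVarietyBetti`,
`kugaSatakeClassMapBetti`, …) and the Literature record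
`Surfaces.Floccari2026_hodgeClasses_algebraic_K3Powers_iff_kugaSatakePowers`, this file records:
* `KSH_K3_Betti` — the real-carrier twin of `KSH_K3`: the Kuga–Satake correspondence of EVERY projective K3
  surface is algebraic (Floccari Conj. 3.3 / Rem. 3.4; Huybrechts Ch. 4 Conj. 2.11; vG 10.2) — OPEN, `@[conjecture]`;
* `hc_K3Powers_of_KSH_betti_of_floccari` — **the row-1 junction on real carriers, `KSH_K3_Betti → HC_AV →
  HC_K3Powers`, PROVED modulo the single record** (direction ⇐ of Thm. 3.5; `HC_AV` enters through
  `hc_av_iff` on the abelian-variety powers `A.powSucc m` of the Kuga–Satake varieties);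
* `hc_K3Powers_at_of_ksCorrespondenceAlgebraic` — the per-surface form (what the unconditional instances
  Floccari Thm. 1.2 / 5.11 feed: `S` with algebraic Kuga–Satake correspondence);
* `exists_isKugaSatakeVarietyBetti` — **Kuga–Satake varieties EXIST on the real carriers, unconditionally in
  the kernel**: the Literature lemma (vG §5.7/§8.1, Floccari §3.2; Kuga–Satake polarisability
  `kugaSatake_exists_polarization_traceForm_holds` + effectivity + strictness) fed with the tree's THEOREM
  `CorCM.deligneMilne1982_Thm_6_20_essImage_holds` (Riemann) — so the `∀ (A, B, θ)` binders of `KSH_K3_Betti`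
  and of the record are inhabited.
So row 1's "beyond `HC_AV`" is, in the kernel, EXACTLY `KSH_K3_Betti` modulo one printed theorem — matching the
companion document's reading of Thm. 3.5 ("row 1 and the `KS(S)`-part of stage 3 are the same problem modulo
KSH").  Kernel wiring only; nothing asserted beyond the named fact taken as a hypothesis.
-/

noncomputable section

open CategoryTheory MonoidalCategory
open Literature.AlgebraicGeometry
open Literature.AlgebraicGeometry.Motives (SchemeOver IsSmoothProjective AbelianVariety HodgeStructure)
open Literature.AlgebraicGeometry.HodgeTheory
open Literature.AlgebraicGeometry.Surfaces (IsK3Surface Floccari2026_hodgeClasses_algebraic_K3Powers_iff_kugaSatakePowers)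

namespace Summit.HodgeConjecture.CorCM.Stage4

/-- INPUT BEYOND `HC_AV` (row 1), the published OPEN conjecture on the REAL carriers (twin of the framework-`B`
`KSH_K3`): for every complex projective K3 surface `S`, the Kuga–Satake correspondence of `S` is algebraic —
Floccari 2026 Conj. 3.3 in the `H²_tr`-form of Remark 3.4 (= Huybrechts, K3 book, Ch. 4 Conj. 2.11 for the
transcendental lattice; van Geemen 2000, 10.2–10.3), i.e. the tree's predicate
`HodgeTheory.IsKSCorrespondenceAlgebraicBetti` at `S`.  Status: "It has been proven for many K3 surfaces of
Picard rank at least `17` ([Morrison 1985]), but it is widely open otherwise" (Floccari §3.3); known for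
`T(S)_ℚ ↪ U³ ⊕ ⟨-m⟩` (Floccari Thm. 5.11) and the `S_K` of `Kumⁿ`-varieties (Thm. 1.2).
[cite: Floccari2026, Conj. 3.3 and Remark 3.4 (§3.3)] [cite: Huybrechts2016K3, Ch. 4 Conj. 2.11]
[cite: vanGeemen2000KugaSatakeHC, §10.2] -/
@[conjecture] def KSH_K3_Betti : Prop :=
  ∀ ⦃S : SchemeOver ℂ⦄ (hS : IsK3Surface S), IsKSCorrespondenceAlgebraicBetti hS.isSmoothProjective

/-- **The row-1 junction on real carriers — `KSH_K3_Betti → HC_AV → HC_K3Powers` — PROVED modulo ONE named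
published fact** (Floccari 2026 Thm. 3.5, direction ⇐: "as Conjecture 3.3 holds for `S` by assumption, we have
`𝔥²(S) ∈ ⟨𝔥¹(KS(S))⟩_Mot`, and the Hodge conjecture for all powers of `KS(S)` clearly implies the Hodge conjecture
for all powers of `S`").  `HC_AV` (BY NAME, stage 3's conclusion) supplies the Hodge conjecture for the
abelian-variety powers `A.powSucc m` of every Kuga–Satake variety `A` of `H²_tr(S, ℚ)`. [cite: Floccari2026, Thm. 3.5 (§3.4)] -/
theorem hc_K3Powers_of_KSH_betti_of_floccari (h35 : Floccari2026_hodgeClasses_algebraic_K3Powers_iff_kugaSatakePowers) :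
    KSH_K3_Betti → HC_AV → HC_K3Powers :=
  fun hKS hAV _ hS m ↦
    Floccari2026_hodgeClasses_algebraic_K3Powers_iff_kugaSatakePowers.hodgeConjectureFor_pow_of_forall_abelianVariety h35
      (hc_av_iff.mp hAV) hS (hKS hS) m

/-- Per-surface form of the junction: `HC_AV` and the algebraicity of the Kuga–Satake correspondence of ONE
projective K3 surface `S` give the Hodge conjecture for every power `Sᵐ` (modulo the record).
[cite: Floccari2026, Thm. 3.5 (§3.4)] -/
theorem hc_K3Powers_at_of_ksCorrespondenceAlgebraic
    (h35 : Floccari2026_hodgeClasses_algebraic_K3Powers_iff_kugaSatakePowers) (hAV : HC_AV) {S : SchemeOver ℂ}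
    (hS : IsK3Surface S) (hKS : IsKSCorrespondenceAlgebraicBetti hS.isSmoothProjective) (m : ℕ) :
    HodgeConjectureFor (m * 2) (S.pow m) :=
  Floccari2026_hodgeClasses_algebraic_K3Powers_iff_kugaSatakePowers.hodgeConjectureFor_pow_of_forall_abelianVariety h35
    (hc_av_iff.mp hAV) hS hKS m

/-- The converse direction (⇒) of Thm. 3.5 in kernel form: the Hodge conjecture for all powers of a projective K3
surface `S` with algebraic Kuga–Satake correspondence gives the Hodge conjecture for all abelian-variety powers of
every Kuga–Satake variety of `H²_tr(S, ℚ)` — instances of `HC_AV` on (in general non-CM, `2^19`-dimensional for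
`ρ = 1`) abelian varieties (companion document §1(b): "row 1 and the `KS(S)`-part of stage 3 are the same problem
modulo KSH"). [cite: Floccari2026, Thm. 3.5 (§3.4)] -/
theorem hc_kugaSatakePowers_of_hc_K3Powers_at
    (h35 : Floccari2026_hodgeClasses_algebraic_K3Powers_iff_kugaSatakePowers) {S : SchemeOver ℂ} (hS : IsK3Surface S)
    (hKS : IsKSCorrespondenceAlgebraicBetti hS.isSmoothProjective) (hHC : ∀ m : ℕ, HodgeConjectureFor (m * 2) (S.pow m))
    (M : HodgeModel 2 S) (hM : M.IsHodgeSymmetric) {T : Type} [AddCommGroup T] [Module ℚ T]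
    (H : HodgeStructure T 2) (P : H.Polarization) (hT : H.hodgeNumber 2 0 = 1) (ε : ℤˣ)
    (j : H.Hom (bettiTwoHodgeStructure hS.isSmoothProjective M hM))
    (hj : IsTranscendentalPartBetti hS.isSmoothProjective M hM H P ε j)
    (A : AbelianVariety ℂ) (B : HodgeModel A.dim A.X) (hB : B.IsHodgeSymmetric)
    (θ : Motives.bettiCohomology A.X 1 ≃ₗ[ℚ] CliffordAlgebra.even P.quadraticForm)
    (hθ : IsKugaSatakeVarietyBetti H P hT A B hB θ) (m : ℕ) :
    HodgeConjectureFor (A.powSucc m).dim (A.powSucc m).X :=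
  (h35 hS hKS).mp hHC M hM T H P hT ε j hj A B hB θ hθ m

/-- **Kuga–Satake varieties exist on the real carriers, unconditionally in the kernel**: for a
finite-dimensional polarized `ℚ`-Hodge structure `(T, H, P)` of K3 type with an orthogonal pair `e₁, e₂`,
`P(eᵢ, eᵢ) < 0` (vG 5.2), there are a complex abelian variety `A`, a Hodge-symmetric Hodge model `B` and
`θ : H¹(A(ℂ); ℚ) ≃ C⁺(Q)` carrying `H¹_B(A)` onto the Kuga–Satake structure (`IsKugaSatakeVarietyBetti`) — the
Literature lemma `Surfaces.exists_isKugaSatakeVarietyBetti` (Kuga–Satake polarisability, effectivity, strictness: all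
proved) fed with Riemann's theorem as the tree THEOREM `CorCM.deligneMilne1982_Thm_6_20_essImage_holds`.  Hence
the `∀ (A, B, θ)` binders of `KSH_K3_Betti` and of the Floccari record are inhabited.
[cite: vanGeemen2000KugaSatakeHC, §5.7 and §8.1] [cite: Floccari2026, §3.2] -/
theorem exists_isKugaSatakeVarietyBetti {T : Type} [AddCommGroup T] [Module ℚ T] [Module.Finite ℚ T]
    (H : HodgeStructure T 2) (P : H.Polarization) (hK3 : H.IsOfK3Type)
    (he : ∃ e₁ e₂ : T, P.form e₁ e₂ = 0 ∧ P.form e₁ e₁ < 0 ∧ P.form e₂ e₂ < 0) :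
    ∃ (A : AbelianVariety ℂ) (B : HodgeModel A.dim A.X) (hB : B.IsHodgeSymmetric)
      (θ : Motives.bettiCohomology A.X 1 ≃ₗ[ℚ] CliffordAlgebra.even P.quadraticForm),
      IsKugaSatakeVarietyBetti H P hK3.1 A B hB θ :=
  Surfaces.exists_isKugaSatakeVarietyBetti CorCM.deligneMilne1982_Thm_6_20_essImage_holds H P hK3 he

end Summit.HodgeConjecture.CorCM.Stage4

end
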